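import Literature.MathematicalPhysics.KineticTheory.ReyBelletThomas2002InteractionCore
import Literature.MathematicalPhysics.KineticTheory.ReyBelletThomas2002PinningCore
import Literature.MathematicalPhysics.KineticTheory.ReyBelletThomas2002EnergyIdentity
import HarnessLib

/-!
# Rey-Bellet–Thomas 2002 with `k₁ < k₂`: the cell estimates in the original variables

Trunk T-KINETIC (Literature/MathematicalPhysics/KineticTheory). Inline step towards Theorem 3.10 / 2.1
of Rey-Bellet–Thomas, CMP **225** (2002), for the named fact `ReyBelletThomas2002_thm21` in the
regime `k₁ < k₂`, where the Liapunov bound is proved along the two-regime scheme of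
Cuneo–Eckmann–Hairer–Rey-Bellet, EJP **23** (2018) §5 with a state-dependent cell length
(interaction cells of length `~ t_i = E^{1/k₂-1/2}`, pinning cells of length `~ t_p = E^{1/k₁-1/2}`).
The deterministic, pathwise inputs of the grid argument, in the ORIGINAL variables:

* `OscillatorChain.rb_energy_apriori₂`, `rb_energy_barrier₂`, `rb_cell_energy_le₂` — the energy
  a-priori bounds, the barrier estimate for `√(G∘y + c)` along a driven trajectory and **the cell
  energy bound** (`G ≤ 2E` on a cell of length `≤ 2Λ₀ t_k` for noise `≤ m₀ E^{1/k}`, any `k ≥ 2`),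
  for potentials with TWO growth exponents `k₁, k₂ ≥ 1` (the tree's versions in
  `ReyBelletThomas2002Dissipation.lean` require `k₁ = k₂`; same proofs);
* `OscillatorChain.rb_cell_dissipation_ge_of_scaled` — **transport of a rescaled dissipation bound
  to the original variables** for an arbitrary scaling exponent `k` and a regime predicate
  preserved by the rescaling (rescale by (19), `isIntegralSolutionOn_rbScale₂`, scale the
  dissipation back by (24));
* `OscillatorChain.rb_cell_dissipation_ge_interaction` / `rb_cell_dissipation_ge_pinning` —
  **CEHR Prop. 5.3 on a cell, original variables**: for `E` large, `G(x) ≥ E/2`, a cell of length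
  `≥ Λ₀ t_i` (resp. `≥ Λ₀ t_p`), a start in the interaction regime `H_pin ≤ H_int` (resp. pinning
  regime `H_int ≤ H_pin`), noise `≤ δ₀E^{1/k₂}` (resp. `≤ δ₀E^{1/k₁}`) and energy `≤ 4E` along the
  cell, `∫₀^τ(r_L² + r_R²) ≥ ε₁E^{3/k₂-1/2}` (resp. `≥ ε₁E^{3/k₁-1/2}`).

## References

* L. Rey-Bellet, L. E. Thomas, Comm. Math. Phys. **225** (2002) 305–329, §3.1 Thm 3.3, Cor 3.6,
  eq. (24); §3.2 Prop 3.7, Thm 3.10 (p. 24).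
* N. Cuneo, J.-P. Eckmann, M. Hairer, L. Rey-Bellet, Electron. J. Probab. **23** (2018) no. 55,
  Prop. 5.3, §5.1–5.2.
-/

noncomputable section

open MeasureTheory Filter Topology Set intervalIntegral Metric
open scoped NNReal

namespace Literature.MathematicalPhysics.KineticTheory.HeatConduction

open Literature.Analysis.ODE Literature.MathematicalPhysics.KineticTheory

variable {N : ℕ}

section Cell

variable {P : OscillatorChain} {k₁ k₂ : ℝ} (hU : RBGrowth P.U k₁) (hV : RBGrowth P.V k₂)
  (hk₁ : 1 ≤ k₁) (hk₂ : 1 ≤ k₂) (hγ : 0 ≤ P.γ) (Λ : ℝ)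
include hU hV hk₁ hk₂

namespace OscillatorChain

variable (N) in
/-- **A-priori bounds from the energy** (original variables, growth exponents `k₁, k₂ ≥ 1`): there is
`c ≥ 1` with `r_b² ≤ 2(G(y) + c)`, `p_i² ≤ 2(G(y) + c)` and `G(y) + c ≥ 1` (generalizes
`rb_energy_apriori`, which requires `k₁ = k₂`). [cite: ReyBelletThomas2002, §3.1] -/
theorem rb_energy_apriori₂ : ∃ c : ℝ, 1 ≤ c ∧ ∀ y : RBPhaseSpace N,
    1 ≤ P.rbEnergy N y + c ∧ y.2.1 ^ 2 ≤ 2 * (P.rbEnergy N y + c) ∧ y.2.2 ^ 2 ≤ 2 * (P.rbEnergy N y + c) ∧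
      ∀ i, y.1.2 i ^ 2 ≤ 2 * (P.rbEnergy N y + c) := by
  have hk10 : 0 < k₁ := by linarith
  have hk20 : 0 < k₂ := by linarith
  obtain ⟨CU, hCU, hUge⟩ := hU.exists_rpow_sub_le hk10
  obtain ⟨CV, hCV, hVge⟩ := hV.exists_rpow_sub_le hk20
  have haU := hU.coeff_pos
  have haV := hV.coeff_pos
  have hUb : ∀ y, -CU ≤ P.U y := fun y => by
    have h1 := hUge y
    have : 0 ≤ hU.coeff / 2 * |y| ^ k₁ := by positivity
    linarith
  have hVb : ∀ y, -CV ≤ P.V y := fun y => by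
    have h1 := hVge y
    have : 0 ≤ hV.coeff / 2 * |y| ^ k₂ := by positivity
    linarith
  refine ⟨N * CU + N ^ 2 * CV + CU + 1, by nlinarith [sq_nonneg (N : ℝ), (Nat.cast_nonneg N : (0:ℝ) ≤ N)],
    fun y => ?_⟩
  have hkin := P.kinetic_le_hamiltonian (by linarith : -CV ≤ 0) hUb hVb N y.1
  have hsum0 : 0 ≤ ∑ i, y.1.2 i ^ 2 / 2 := Finset.sum_nonneg fun i _ => by positivity
  have hG : P.rbEnergy N y = (y.2.1 ^ 2 + y.2.2 ^ 2) / 2 + P.hamiltonian N y.1 := rfl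
  have hN0 : (0 : ℝ) ≤ N := Nat.cast_nonneg N
  refine ⟨?_, ?_, ?_, fun i => ?_⟩
  · nlinarith [sq_nonneg y.2.1, sq_nonneg y.2.2]
  · nlinarith [sq_nonneg y.2.2]
  · nlinarith [sq_nonneg y.2.1]
  · have h1 := P.sq_add_U_le_hamiltonian (by linarith : -CU ≤ 0) (by linarith : -CV ≤ 0) hUb hVb N y.1 i
    have h2 := hUb (y.1.1 i)
    nlinarith [sq_nonneg y.2.1, sq_nonneg y.2.2]

-- the flow is a limit of Picard iterations: never let the unifier unfold it (heartbeats)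
attribute [local irreducible] OscillatorChain.rbFlow

include hγ in
/-- **The barrier estimate for the energy along a driven trajectory** (growth exponents
`k₁, k₂ ≥ 1`; generalizes `rb_energy_barrier`, which requires `k₁ = k₂`). With `c` the a-priori
constant, `A = 3(γ + N|Λ| + 1)` and any `ι > 0`: if `|η_b| ≤ m` on `[0, τ]` then for `s ∈ [0, τ]`,
with `B := max(√(G(x)+c), m) + (A m + ι) s`, `G(z(s)) ≤ B² - c + 3 B m + m²` for the flow
`z = rbFlow x η` (`y = z - (0, η)` is `C¹` with `y' = Y(z)`,
`(G∘y)' = -η·Y(z)_r - γ|r_z|² ≤ A m √(G∘y + c) + 2γm²`, so `√(G∘y + c)` stays below the barrier).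
[cite: ReyBelletThomas2002, Prop 3.7 & Thm 3.10 (p. 24, `G(x(t)) = O(E)`)] -/
theorem rb_energy_barrier₂ : ∃ c : ℝ, 1 ≤ c ∧ ∀ (x : RBPhaseSpace N) ⦃η : ℝ → ℝ × ℝ⦄, Continuous η →
    ∀ ⦃τ m ι : ℝ⦄, 0 ≤ m → 0 < ι → (∀ s ∈ Icc 0 τ, |(η s).1| ≤ m ∧ |(η s).2| ≤ m) →
      ∀ s ∈ Icc 0 τ, P.rbEnergy N (P.rbFlow Λ N x η s) ≤
        (max (Real.sqrt (P.rbEnergy N x + c)) m + (3 * (P.γ + N * |Λ| + 1) * m + ι) * s) ^ 2 - c +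
          3 * (max (Real.sqrt (P.rbEnergy N x + c)) m + (3 * (P.γ + N * |Λ| + 1) * m + ι) * s) * m +
          m ^ 2 := by
  obtain ⟨c, hc1, hapr⟩ := rb_energy_apriori₂ (N := N) hU hV hk₁ hk₂
  have hN0 : (0 : ℝ) ≤ N := Nat.cast_nonneg N
  have hUd : Differentiable ℝ P.U := hU.differentiable
  have hVd : Differentiable ℝ P.V := hV.differentiable
  refine ⟨c, hc1, fun x η hηc τ m ι hm0 hι0 hηm s hs => ?_⟩
  have hΛ := abs_nonneg Λ
  -- the slope constant `a = A m` and the constant `K` with `a K = 2 γ m²`, `K ≤ m`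
  set A : ℝ := 3 * (P.γ + N * |Λ| + 1) with hA
  have hA0 : 0 < A := by positivity
  set a : ℝ := A * m with ha
  have ha0 : 0 ≤ a := by positivity
  set K : ℝ := 2 * P.γ * m / (3 * (P.γ + N * |Λ| + 1)) with hK
  have hK0 : 0 ≤ K := by positivity
  have haK : a * K = 2 * P.γ * m ^ 2 := by
    rw [ha, hA, hK]; field_simp
  have hKm : K ≤ m := by
    rw [hK, div_le_iff₀ (by positivity)]
    nlinarith [mul_nonneg hm0 (mul_nonneg hN0 hΛ), mul_nonneg hm0 hγ, hm0]
  -- the flow, the drift-driven part and their calculus (as in the energy identity)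
  set G := P.rbEnergy N with hGdef
  set Y := P.rbDrift Λ N with hYdef
  set z := P.rbFlow Λ N x η with hzdef
  have hH : Differentiable ℝ (P.hamiltonian N) :=
    (P.contDiff_hamiltonian hU.1 hV.1 N).differentiable (by simp)
  have hYc : Continuous Y := (P.contDiff_rbDrift hU.1 hV.1 Λ N).continuous
  have hzc : Continuous z := continuous_rbFlow hU hV hk₁ hk₂ hγ Λ N x hηc
  have hz_eq : ∀ u ∈ Icc 0 τ, z u = (x + ((0 : PhaseSpace N), η u)) + ∫ r in (0 : ℝ)..u, Y (z r) :=
    isIntegralSolutionOn_rbFlow hU hV hk₁ hk₂ hγ Λ N x hηc τ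
  have hGs : ContDiff ℝ 1 G := (P.contDiff_rbEnergy hU.1 hV.1 N).of_le (by norm_cast)
  have hGd : Differentiable ℝ G := hGs.differentiable one_ne_zero
  set y : ℝ → RBPhaseSpace N := fun u => x + ∫ r in (0 : ℝ)..u, Y (z r) with hydef
  have hy_deriv : ∀ u, HasDerivAt y (Y (z u)) u := fun u => by
    have h1 : HasDerivAt (fun u => ∫ r in (0 : ℝ)..u, Y (z r)) (Y (z u)) u :=
      ((hYc.comp hzc).integral_hasStrictDerivAt 0 u).hasDerivAt
    exact h1.const_add x
  have hz_y : ∀ u ∈ Icc 0 τ, z u = y u + ((0 : PhaseSpace N), η u) := fun u hu => by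
    rw [hz_eq u hu]; simp only [hydef]; abel
  have hy0 : y 0 = x := by simp [hydef]
  -- `f = G ∘ y`, `f' = DG(y)·Y(z)`, `g = √(f + c)`
  set f : ℝ → ℝ := fun u => G (y u) with hfdef
  set f' : ℝ → ℝ := fun u => fderiv ℝ G (y u) (Y (z u)) with hf'def
  have hf_deriv : ∀ u, HasDerivAt f (f' u) u := fun u =>
    (hGd (y u)).hasFDerivAt.comp_hasDerivAt u (hy_deriv u)
  set g : ℝ → ℝ := fun u => Real.sqrt (f u + c) with hgdef
  have hfc1 : ∀ u, 1 ≤ f u + c := fun u => (hapr (y u)).1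
  have hg_pos : ∀ u, 0 < g u := fun u => Real.sqrt_pos.2 (by linarith only [hfc1 u])
  have hg_sq : ∀ u, g u ^ 2 = f u + c := fun u => Real.sq_sqrt (by linarith only [hfc1 u])
  have habs : ∀ v w : ℝ, 0 ≤ w → v ^ 2 ≤ w ^ 2 → |v| ≤ w := fun v w hw h => by
    rw [← Real.sqrt_sq_eq_abs, ← Real.sqrt_sq hw]; exact Real.sqrt_le_sqrt h
  have hcomp : ∀ u, |(y u).2.1| ≤ 3 / 2 * g u ∧ |(y u).2.2| ≤ 3 / 2 * g u ∧
      ∀ i, |(y u).1.2 i| ≤ 3 / 2 * g u := by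
    intro u
    obtain ⟨-, h1, h2, h3⟩ := hapr (y u)
    have hg := hg_sq u
    have hgp := (hg_pos u).le
    have e : (3 / 2 * g u) ^ 2 = 9 / 4 * (f u + c) := by rw [mul_pow, hg]; ring
    refine ⟨habs _ _ (by positivity) ?_, habs _ _ (by positivity) ?_, fun i => habs _ _ (by positivity) ?_⟩
    · rw [e]; have h1' : (y u).2.1 ^ 2 ≤ 2 * (f u + c) := h1; linarith only [h1', hfc1 u]
    · rw [e]; have h2' : (y u).2.2 ^ 2 ≤ 2 * (f u + c) := h2; linarith only [h2', hfc1 u]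
    · rw [e]; have h3' : (y u).1.2 i ^ 2 ≤ 2 * (f u + c) := h3 i; linarith only [h3', hfc1 u]
  -- the `r`-components of the drift
  have hYr : ∀ w : RBPhaseSpace N,
      (Y w).2.1 = -(P.γ * w.2.1) + Λ * ∑ i : Fin N, (if i.val = 0 then w.1.2 i else 0) ∧
      (Y w).2.2 = -(P.γ * w.2.2) + Λ * ∑ i : Fin N, (if i.val = N - 1 then w.1.2 i else 0) := by
    intro w
    simp only [hYdef, P.rbDrift_eq hUd hVd Λ N, and_self]
  have hsum : ∀ u, ∀ (cnd : Fin N → Prop) [DecidablePred cnd],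
      |∑ i : Fin N, (if cnd i then (y u).1.2 i else 0)| ≤ N * (3 / 2 * g u) := by
    intro u cnd _
    refine (Finset.abs_sum_le_sum_abs _ _).trans ?_
    have : ∀ i ∈ (Finset.univ : Finset (Fin N)), |(if cnd i then (y u).1.2 i else 0)| ≤ 3 / 2 * g u :=
      fun i _ => by
        split_ifs
        · exact (hcomp u).2.2 i
        · rw [abs_zero]; linarith only [hg_pos u]
    refine (Finset.sum_le_sum this).trans ?_
    rw [Finset.sum_const, Finset.card_univ, Fintype.card_fin, nsmul_eq_mul]
  have hYb : ∀ u ∈ Icc 0 τ, |(Y (z u)).2.1| ≤ 3 / 2 * (P.γ + N * |Λ|) * g u + P.γ * m ∧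
      |(Y (z u)).2.2| ≤ 3 / 2 * (P.γ + N * |Λ|) * g u + P.γ * m := by
    intro u hu
    obtain ⟨e1, e2⟩ := hYr (z u)
    have hz1 : (z u).1 = (y u).1 := by rw [hz_y u hu]; simp
    have hz21 : (z u).2.1 = (y u).2.1 + (η u).1 := by rw [hz_y u hu]; simp
    have hz22 : (z u).2.2 = (y u).2.2 + (η u).2 := by rw [hz_y u hu]; simp
    obtain ⟨hr1, hr2, -⟩ := hcomp u
    obtain ⟨hη1, hη2⟩ := hηm u hu
    constructor
    · rw [e1, hz1, hz21]
      refine (abs_add_le _ _).trans ?_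
      rw [abs_neg, abs_mul, abs_of_nonneg hγ, abs_mul]
      have h1 : P.γ * |(y u).2.1 + (η u).1| ≤ P.γ * (3 / 2 * g u + m) :=
        mul_le_mul_of_nonneg_left ((abs_add_le _ _).trans (add_le_add hr1 hη1)) hγ
      have h2 : |Λ| * |∑ i : Fin N, (if i.val = 0 then (y u).1.2 i else 0)| ≤ |Λ| * (N * (3 / 2 * g u)) :=
        mul_le_mul_of_nonneg_left (hsum u _) hΛ
      have e : 3 / 2 * (P.γ + N * |Λ|) * g u + P.γ * m = P.γ * (3 / 2 * g u + m) + |Λ| * (N * (3 / 2 * g u)) := by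
        ring
      rw [e]; exact add_le_add h1 h2
    · rw [e2, hz1, hz22]
      refine (abs_add_le _ _).trans ?_
      rw [abs_neg, abs_mul, abs_of_nonneg hγ, abs_mul]
      have h1 : P.γ * |(y u).2.2 + (η u).2| ≤ P.γ * (3 / 2 * g u + m) :=
        mul_le_mul_of_nonneg_left ((abs_add_le _ _).trans (add_le_add hr2 hη2)) hγ
      have h2 : |Λ| * |∑ i : Fin N, (if i.val = N - 1 then (y u).1.2 i else 0)| ≤ |Λ| * (N * (3 / 2 * g u)) :=
        mul_le_mul_of_nonneg_left (hsum u _) hΛ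
      have e : 3 / 2 * (P.γ + N * |Λ|) * g u + P.γ * m = P.γ * (3 / 2 * g u + m) + |Λ| * (N * (3 / 2 * g u)) := by
        ring
      rw [e]; exact add_le_add h1 h2
  -- `f' ≤ a g + a K` on `[0, τ]`
  have hf'le : ∀ u ∈ Icc 0 τ, f' u ≤ a * g u + a * K := by
    intro u hu
    have h := fderiv_rbEnergy_rbDrift_eq hH Λ (y u) (η u)
    rw [← hz_y u hu] at h
    have hf'u : f' u = -((η u).1 * (Y (z u)).2.1 + (η u).2 * (Y (z u)).2.2) -
        P.γ * (((y u).2.1 + (η u).1) ^ 2 + ((y u).2.2 + (η u).2) ^ 2) := h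
    rw [hf'u, haK]
    obtain ⟨b1, b2⟩ := hYb u hu
    obtain ⟨hη1, hη2⟩ := hηm u hu
    have hsq : 0 ≤ P.γ * (((y u).2.1 + (η u).1) ^ 2 + ((y u).2.2 + (η u).2) ^ 2) := by positivity
    have h1 : -((η u).1 * (Y (z u)).2.1) ≤ m * (3 / 2 * (P.γ + N * |Λ|) * g u + P.γ * m) := by
      have h' : |(η u).1| * |(Y (z u)).2.1| ≤ m * (3 / 2 * (P.γ + N * |Λ|) * g u + P.γ * m) :=
        mul_le_mul hη1 b1 (abs_nonneg _) hm0
      rw [← abs_mul] at h'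
      linarith only [h', neg_abs_le ((η u).1 * (Y (z u)).2.1)]
    have h2 : -((η u).2 * (Y (z u)).2.2) ≤ m * (3 / 2 * (P.γ + N * |Λ|) * g u + P.γ * m) := by
      have h' : |(η u).2| * |(Y (z u)).2.2| ≤ m * (3 / 2 * (P.γ + N * |Λ|) * g u + P.γ * m) :=
        mul_le_mul hη2 b2 (abs_nonneg _) hm0
      rw [← abs_mul] at h'
      linarith only [h', neg_abs_le ((η u).2 * (Y (z u)).2.2)]
    have hmg : 0 ≤ m * g u := mul_nonneg hm0 (hg_pos u).le
    have e : a * g u + 2 * P.γ * m ^ 2 =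
        2 * (m * (3 / 2 * (P.γ + N * |Λ|) * g u + P.γ * m)) + 3 * (m * g u) := by
      rw [ha, hA]; ring
    rw [e]
    linarith only [h1, h2, hsq, hmg]
  -- the barrier argument for `g`
  have hg_deriv : ∀ u, HasDerivAt g (f' u / (2 * Real.sqrt (f u + c))) u := fun u =>
    ((hf_deriv u).add_const c).sqrt (by linarith only [hfc1 u])
  have hgc : Continuous g := continuous_iff_continuousAt.2 fun u => (hg_deriv u).continuousAt
  set B₀ : ℝ := max (g 0) m with hB₀
  have hbar : ∀ u ∈ Icc 0 τ, g u ≤ B₀ + (a + ι) * u := by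
    intro u hu
    refine image_le_of_deriv_right_lt_deriv_boundary' (f := g)
      (f' := fun u => f' u / (2 * Real.sqrt (f u + c)))
      (a := 0) (b := τ) hgc.continuousOn (fun v _ => (hg_deriv v).hasDerivWithinAt)
      (B := fun u => B₀ + (a + ι) * u) (B' := fun _ => a + ι)
      (by rw [mul_zero, add_zero]; exact le_max_left _ _)
      (by fun_prop)
      (fun v _ => (((hasDerivAt_id v).const_mul (a + ι)).const_add B₀).hasDerivWithinAt.congr_deriv (mul_one _))
      (fun v hv hvB => ?_) hu
    -- at a touching point `g v = B₀ + (a + ι) v ≥ m ≥ K`, so `g' ≤ (a g + a K)/(2 g) ≤ a < a + ι`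
    have hgK : K ≤ g v := by
      rw [hvB]
      exact hKm.trans ((le_max_right _ _).trans (le_add_of_nonneg_right (mul_nonneg (by positivity) hv.1)))
    have hgv := hg_pos v
    show f' v / (2 * Real.sqrt (f v + c)) < a + ι
    rw [show Real.sqrt (f v + c) = g v from rfl, div_lt_iff₀ (by positivity)]
    have h1 := hf'le v ⟨hv.1, hv.2.le⟩
    have h2 : a * K ≤ a * g v := mul_le_mul_of_nonneg_left hgK ha0
    have h3 : 0 < ι * (2 * g v) := by positivity
    have e : (a + ι) * (2 * g v) = a * g v + a * g v + ι * (2 * g v) := by ring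
    rw [e]
    linarith only [h1, h2, h3]
  -- `G(z s) = f s + r_y·η + |η|²/2`, and the bookkeeping
  have hGz : G (z s) = f s + ((y s).2.1 * (η s).1 + (y s).2.2 * (η s).2 +
      ((η s).1 ^ 2 + (η s).2 ^ 2) / 2) := by
    rw [hz_y s hs]
    have := P.rbEnergy_add_zero_prod N (y s) (η s)
    simp only [hGdef, hfdef] at this ⊢
    linarith only [this]
  obtain ⟨hr1, hr2, -⟩ := hcomp s
  obtain ⟨hη1, hη2⟩ := hηm s hs
  have hfs : f s = g s ^ 2 - c := by rw [hg_sq s]; ring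
  have hp1 : (y s).2.1 * (η s).1 ≤ 3 / 2 * g s * m := by
    have h' : |(y s).2.1| * |(η s).1| ≤ 3 / 2 * g s * m := mul_le_mul hr1 hη1 (abs_nonneg _) (by positivity)
    rw [← abs_mul] at h'
    linarith only [h', le_abs_self ((y s).2.1 * (η s).1)]
  have hp2 : (y s).2.2 * (η s).2 ≤ 3 / 2 * g s * m := by
    have h' : |(y s).2.2| * |(η s).2| ≤ 3 / 2 * g s * m := mul_le_mul hr2 hη2 (abs_nonneg _) (by positivity)
    rw [← abs_mul] at h'
    linarith only [h', le_abs_self ((y s).2.2 * (η s).2)]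
  have hη1sq : (η s).1 ^ 2 ≤ m ^ 2 := by rw [← sq_abs]; exact pow_le_pow_left₀ (abs_nonneg _) hη1 2
  have hη2sq : (η s).2 ^ 2 ≤ m ^ 2 := by rw [← sq_abs]; exact pow_le_pow_left₀ (abs_nonneg _) hη2 2
  -- the barrier value at `s`
  have hB : g s ≤ B₀ + (a + ι) * s := hbar s hs
  have hBdef : B₀ + (a + ι) * s = max (Real.sqrt (G x + c)) m + (3 * (P.γ + N * |Λ| + 1) * m + ι) * s := by
    simp only [hB₀, ha, hA, hgdef, hfdef, hy0]
  have hB0' : 0 ≤ B₀ + (a + ι) * s := (hg_pos s).le.trans hB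
  have hgg : g s ^ 2 ≤ (B₀ + (a + ι) * s) ^ 2 := pow_le_pow_left₀ (hg_pos s).le hB 2
  have hgm : g s * m ≤ (B₀ + (a + ι) * s) * m := mul_le_mul_of_nonneg_right hB hm0
  rw [← hBdef, hGz, hfs]
  linarith only [hgg, hgm, hp1, hp2, hη1sq, hη2sq]

include hγ in
/-- **The cell energy bound** for growth exponents `k₁, k₂ ≥ 1` and an arbitrary time-scale exponent
`k ≥ 2` (generalizes `rb_cell_energy_le`, which requires `k₁ = k₂ = k`): there are `m₀ ∈ (0, 1]`
and `E₁ ≥ 1` such that for `E ≥ E₁`, a start with `G(x) ≤ 3E/2`, a cell length `τ ≤ 2Λ₀ t_k(E)`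
(`t_k(E) = E^{1/k-1/2}`) and a continuous reservoir noise path with `‖η‖ ≤ m₀ E^{1/k}` on `[0, τ]`,
the energy of the driven flow stays `≤ 2E` on `[0, τ]`.
[cite: ReyBelletThomas2002, Prop 3.7 & Thm 3.10 (p. 24, `G(x(t)) = O(E)`)] -/
theorem rb_cell_energy_le₂ {k : ℝ} (hk : 2 ≤ k) {Λ₀ : ℝ} (hΛ₀ : 0 < Λ₀) :
    ∃ m₀ E₁ : ℝ, 0 < m₀ ∧ m₀ ≤ 1 ∧ 1 ≤ E₁ ∧ ∀ ⦃E : ℝ⦄, E₁ ≤ E → ∀ ⦃τ : ℝ⦄, 0 ≤ τ →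
      τ ≤ 2 * Λ₀ * timeScale k E → ∀ x : RBPhaseSpace N, P.rbEnergy N x ≤ 3 * E / 2 →
        ∀ ⦃η : ℝ → ℝ × ℝ⦄, Continuous η → (∀ s ∈ Icc 0 τ, ‖η s‖ ≤ m₀ * E ^ (1 / k)) →
          ∀ s ∈ Icc 0 τ, P.rbEnergy N (P.rbFlow Λ N x η s) ≤ 2 * E := by
  obtain ⟨c, hc1, hbar⟩ := rb_energy_barrier₂ hU hV hk₁ hk₂ hγ Λ (N := N)
  have hc0 : 0 ≤ c := by linarith
  have hN0 : (0 : ℝ) ≤ N := Nat.cast_nonneg N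
  set A : ℝ := 3 * (P.γ + N * |Λ| + 1) with hA
  have hA0 : 0 < A := by positivity
  set C₄ : ℝ := 2 * A * Λ₀ with hC₄
  have hC₄0 : 0 < C₄ := by positivity
  set m₀ : ℝ := min (1 / 40) (1 / (40 * C₄)) with hm₀
  have hm₀0 : 0 < m₀ := lt_min (by norm_num) (by positivity)
  have hm₀40 : m₀ ≤ 1 / 40 := min_le_left _ _
  have hm₀1 : m₀ ≤ 1 := hm₀40.trans (by norm_num)
  have hm₀C : C₄ * m₀ ≤ 1 / 40 := by
    have : m₀ ≤ 1 / (40 * C₄) := min_le_right _ _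
    rw [le_div_iff₀ (by positivity)] at this
    linarith
  refine ⟨m₀, 20 * c, hm₀0, hm₀1, by linarith, ?_⟩
  intro E hE τ hτ0 hτ x hx η hηc hηb s hs
  have hE1 : 1 ≤ E := by linarith
  have hE0 : 0 < E := by linarith
  -- `√E` and the exponent bookkeeping
  set sE : ℝ := Real.sqrt E with hsE
  have hsE0 : 0 < sE := Real.sqrt_pos.2 hE0
  have hsE2 : sE ^ 2 = E := Real.sq_sqrt hE0.le
  have hsE1 : 1 ≤ sE := by rw [hsE, ← Real.sqrt_one]; exact Real.sqrt_le_sqrt hE1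
  have hEk : E ^ (1 / k) ≤ sE := by
    rw [hsE, Real.sqrt_eq_rpow]
    exact Real.rpow_le_rpow_of_exponent_le hE1 (by
      rw [div_le_div_iff₀ (by linarith) (by norm_num)]; linarith)
  have hE2k : E ^ (2 / k - 1 / 2) ≤ sE := by
    rw [hsE, Real.sqrt_eq_rpow]
    exact Real.rpow_le_rpow_of_exponent_le hE1 (by
      have : 2 / k ≤ 1 := by rw [div_le_one (by linarith)]; linarith
      linarith)
  have htE : timeScale k E ≤ 1 := Real.rpow_le_one_of_one_le_of_nonpos hE1 (by
    have : 1 / k ≤ 1 / 2 := by rw [div_le_div_iff₀ (by linarith) (by norm_num)]; linarith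
    linarith)
  -- the noise level `m = m₀ E^{1/k} ≤ sE/40`
  set m : ℝ := m₀ * E ^ (1 / k) with hm
  have hm0 : 0 ≤ m := by positivity
  have hmsE : m ≤ sE / 40 := by
    calc m ≤ m₀ * sE := mul_le_mul_of_nonneg_left hEk hm₀0.le
      _ ≤ 1 / 40 * sE := mul_le_mul_of_nonneg_right hm₀40 hsE0.le
      _ = sE / 40 := by ring
  have hηm : ∀ u ∈ Icc 0 τ, |(η u).1| ≤ m ∧ |(η u).2| ≤ m := fun u hu =>
    ⟨((Real.norm_eq_abs _).symm.le.trans (norm_fst_le (η u))).trans (hηb u hu),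
      ((Real.norm_eq_abs _).symm.le.trans (norm_snd_le (η u))).trans (hηb u hu)⟩
  -- `A m τ ≤ sE/40` and `ι τ ≤ sE/40` for `ι = 1/(80Λ₀ + 40)`
  have haτ : A * m * τ ≤ sE / 40 := by
    have h1 : A * m * τ ≤ A * m * (2 * Λ₀ * timeScale k E) := mul_le_mul_of_nonneg_left hτ (by positivity)
    have h2 : A * m * (2 * Λ₀ * timeScale k E) = C₄ * m₀ * (E ^ (1 / k) * E ^ (1 / k - 1 / 2)) := by
      rw [hm, hC₄, timeScale]; ring
    have h3 : E ^ (1 / k) * E ^ (1 / k - 1 / 2) = E ^ (2 / k - 1 / 2) := by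
      rw [← Real.rpow_add hE0]; congr 1; ring
    rw [h2, h3] at h1
    calc A * m * τ ≤ C₄ * m₀ * E ^ (2 / k - 1 / 2) := h1
      _ ≤ 1 / 40 * sE := mul_le_mul hm₀C hE2k (Real.rpow_nonneg hE0.le _) (by norm_num)
      _ = sE / 40 := by ring
  set ι : ℝ := 1 / (80 * Λ₀ + 40) with hι
  have hι0 : 0 < ι := by positivity
  have hιτ : ι * τ ≤ sE / 40 := by
    have h1 : τ ≤ 2 * Λ₀ := hτ.trans (mul_le_of_le_one_right (by positivity) htE)
    have h2 : ι * τ ≤ ι * (2 * Λ₀) := mul_le_mul_of_nonneg_left h1 hι0.le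
    have h3 : ι * (2 * Λ₀) ≤ 1 / 40 := by
      rw [hι, div_mul_eq_mul_div, div_le_div_iff₀ (by positivity) (by norm_num)]
      linarith only [hΛ₀]
    linarith only [h2, h3, hsE1]
  -- the barrier value
  have hB := hbar x hηc hm0 hι0 hηm s hs
  set B : ℝ := max (Real.sqrt (P.rbEnergy N x + c)) m + (3 * (P.γ + N * |Λ| + 1) * m + ι) * s with hBdef
  have hg0 : Real.sqrt (P.rbEnergy N x + c) ≤ 249 / 200 * sE := by
    rw [Real.sqrt_le_left (by positivity), mul_pow, hsE2]
    nlinarith only [hx, hE, hc0]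
  have hBle : B ≤ 33 / 25 * sE := by
    have h1 : max (Real.sqrt (P.rbEnergy N x + c)) m ≤ 249 / 200 * sE :=
      max_le hg0 (by linarith only [hmsE, hsE0])
    have h2 : (3 * (P.γ + N * |Λ| + 1) * m + ι) * s ≤ sE / 40 + sE / 40 := by
      have e : (3 * (P.γ + N * |Λ| + 1) * m + ι) * s = A * m * s + ι * s := by rw [hA]; ring
      rw [e]
      have h3 : A * m * s ≤ A * m * τ := mul_le_mul_of_nonneg_left hs.2 (by positivity)
      have h4 : ι * s ≤ ι * τ := mul_le_mul_of_nonneg_left hs.2 hι0.le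
      linarith only [h3, h4, haτ, hιτ]
    rw [hBdef]
    linarith only [h1, h2, hsE0]
  have hB0 : 0 ≤ B := by
    rw [hBdef]
    exact add_nonneg ((Real.sqrt_nonneg _).trans (le_max_left _ _)) (mul_nonneg (by positivity) hs.1)
  have hgg : B ^ 2 ≤ 1089 / 625 * sE ^ 2 :=
    calc B ^ 2 ≤ (33 / 25 * sE) ^ 2 := pow_le_pow_left₀ hB0 hBle 2
      _ = 1089 / 625 * sE ^ 2 := by ring
  have hgm : B * m ≤ 33 / 1000 * sE ^ 2 :=
    calc B * m ≤ (33 / 25 * sE) * (sE / 40) := mul_le_mul hBle hmsE hm0 (by positivity)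
      _ = 33 / 1000 * sE ^ 2 := by ring
  have hmm : m ^ 2 ≤ 1 / 1600 * sE ^ 2 :=
    calc m ^ 2 ≤ (sE / 40) ^ 2 := pow_le_pow_left₀ hm0 hmsE 2
      _ = 1 / 1600 * sE ^ 2 := by ring
  have hB' : P.rbEnergy N (P.rbFlow Λ N x η s) ≤ B ^ 2 - c + 3 * B * m + m ^ 2 := hB
  rw [← hsE2]
  linarith only [hB', hgg, hgm, hmm, hc0, sq_nonneg sE]

end OscillatorChain

end Cell

/-! ### Transport of a rescaled dissipation bound to the original variables -/

section Transport

variable {P : OscillatorChain} {k₁ k₂ : ℝ} (hU : RBGrowth P.U k₁) (hV : RBGrowth P.V k₂)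
  (hk₁ : 1 ≤ k₁) (hk₂ : 1 ≤ k₂) (hγ : 0 ≤ P.γ) (Λ : ℝ)
include hU hV hk₁ hk₂ hγ

-- the flow is a limit of Picard iterations: never let the unifier unfold it (heartbeats)
attribute [local irreducible] OscillatorChain.rbFlow

/-- **Transport of a rescaled cell dissipation bound to the original variables.** Let `k > 0` be a
scaling exponent, `R` a predicate on states and `Rs E` predicates on rescaled states with
`R x → Rs E (L_E x)`. If for `E ≥ E₀` every rescaled controlled trajectory on `[0, Λ₀]` with
`G̃_E(x̃(0)) ≥ 1/2`, `Rs E (x̃(0))`, control `≤ δ₀` and `G̃_E ≤ 4` along dissipates `≥ ε₁`, then for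
`E ≥ E₀`, a cell of length `τ ≥ Λ₀ t_k(E)`, a start with `G(x) ≥ E/2` and `R x`, a continuous
reservoir noise path with `η(0) = 0`, `sup_{[0,τ]} ‖η‖ ≤ δ₀ E^{1/k}` and energy `≤ 4E` along the
cell, the driven flow dissipates `∫₀^τ (r_L² + r_R²) ≥ ε₁ E^{3/k-1/2}` (rescale by (19), conjugacy
`isIntegralSolutionOn_rbScale₂`, scale the dissipation back by (24), monotonicity in `τ`).
[cite: ReyBelletThomas2002, Cor 3.6 & eq. (24)] -/
theorem OscillatorChain.rb_cell_dissipation_ge_of_scaled (k : ℝ) {Λ₀ : ℝ} (hΛ₀ : 0 < Λ₀)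
    (R : RBPhaseSpace N → Prop) (Rs : ℝ → RBPhaseSpace N → Prop)
    (hR : ∀ E : ℝ, 0 < E → ∀ x, R x → Rs E (rbScaleCLM N k E x))
    {E₀ δ₀ ε₁ : ℝ} (hE₀ : 1 ≤ E₀)
    (hT5 : ∀ E : ℝ, E₀ ≤ E → ∀ (x : ℝ → RBPhaseSpace N) (η : ℝ → ℝ × ℝ), Continuous x →
      IsIntegralSolutionOn ((P.rbScaled k E).rbDriftGen Λ N (E ^ (2 / k - 1)) (E ^ (1 / k - 1 / 2)))
        (fun s => x 0 + ((0 : PhaseSpace N), η s)) x Λ₀ →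
      1 / 2 ≤ P.rbScaledEnergy k E N (x 0) → Rs E (x 0) →
      (∀ s ∈ Icc 0 Λ₀, ‖η s‖ ≤ δ₀) → (∀ s ∈ Icc 0 Λ₀, P.rbScaledEnergy k E N (x s) ≤ 4) →
      ε₁ ≤ ∫ s in (0 : ℝ)..Λ₀, ((x s).2.1 ^ 2 + (x s).2.2 ^ 2)) :
    ∀ ⦃E : ℝ⦄, E₀ ≤ E → ∀ ⦃τ : ℝ⦄, Λ₀ * timeScale k E ≤ τ →
      ∀ x : RBPhaseSpace N, E / 2 ≤ P.rbEnergy N x → R x →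
        ∀ ⦃η : ℝ → ℝ × ℝ⦄, Continuous η → η 0 = 0 → (∀ s ∈ Icc 0 τ, ‖η s‖ ≤ δ₀ * E ^ (1 / k)) →
          (∀ s ∈ Icc 0 τ, P.rbEnergy N (P.rbFlow Λ N x η s) ≤ 4 * E) →
            ε₁ * E ^ (3 / k - 1 / 2) ≤
              ∫ s in (0 : ℝ)..τ, ((P.rbFlow Λ N x η s).2.1 ^ 2 + (P.rbFlow Λ N x η s).2.2 ^ 2) := by
  intro E hE τ hτ1 x hGx hRx η hηc hη0 hηb hGz
  have hE1 : 1 ≤ E := hE₀.trans hE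
  have hE0 : 0 < E := by linarith
  set tE := timeScale k E with htE
  have htE0 : 0 < tE := timeScale_pos k hE0
  set L := rbScaleCLM N k E with hL
  set z := P.rbFlow Λ N x η with hz
  have hzc : Continuous z := OscillatorChain.continuous_rbFlow hU hV hk₁ hk₂ hγ Λ N x hηc
  have hzIE : IsIntegralSolutionOn (P.rbDrift Λ N) (fun t => x + ((0 : PhaseSpace N), η t)) z τ :=
    OscillatorChain.isIntegralSolutionOn_rbFlow hU hV hk₁ hk₂ hγ Λ N x hηc τ
  -- the rescaled trajectory and noise
  set xs : ℝ → RBPhaseSpace N := fun s => L (z (tE * s)) with hxs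
  set ηs : ℝ → ℝ × ℝ := fun s => E ^ (-(1 / k)) • η (tE * s) with hηs
  have hxsc : Continuous xs := L.continuous.comp (hzc.comp (continuous_const.mul continuous_id))
  have hΛτ : ∀ s ∈ Icc 0 Λ₀, tE * s ∈ Icc 0 τ := fun s hs =>
    ⟨mul_nonneg htE0.le hs.1, (mul_le_mul_of_nonneg_left hs.2 htE0.le).trans (by rw [mul_comm]; exact hτ1)⟩
  have hxs0 : xs 0 = L x := by
    have h0 : z 0 = x + ((0 : PhaseSpace N), η 0) := by
      have := hzIE 0 ⟨le_rfl, (mul_nonneg hΛ₀.le htE0.le).trans hτ1⟩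
      rw [intervalIntegral.integral_same, add_zero] at this
      exact this
    simp only [hxs, mul_zero, h0, hη0]
    rw [show (((0 : PhaseSpace N), (0 : ℝ × ℝ)) : RBPhaseSpace N) = 0 from rfl, add_zero]
  have hLnoise : ∀ s, L (((0 : PhaseSpace N), η (tE * s)) : RBPhaseSpace N) = ((0 : PhaseSpace N), ηs s) := by
    intro s
    simp only [hL, rbScaleCLM_apply, hηs, Prod.fst_zero, Prod.snd_zero, smul_zero]
    rfl
  have hscaled := isIntegralSolutionOn_rbScale₂ hU hV k hE0 Λ N hzIE hzc
  have hIE : IsIntegralSolutionOn ((P.rbScaled k E).rbDriftGen Λ N (E ^ (2 / k - 1)) (E ^ (1 / k - 1 / 2)))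
      (fun s => xs 0 + ((0 : PhaseSpace N), ηs s)) xs Λ₀ := by
    intro s hs
    have hs' : s ∈ Icc 0 (τ / tE) := ⟨hs.1, hs.2.trans (by rw [le_div_iff₀ htE0]; exact hτ1)⟩
    have h1 : xs s = (L x + L (((0 : PhaseSpace N), η (tE * s)) : RBPhaseSpace N)) +
        ∫ u in (0 : ℝ)..s, (P.rbScaled k E).rbDriftGen Λ N (E ^ (2 / k - 1)) (E ^ (1 / k - 1 / 2)) (xs u) :=
      hscaled s hs'
    rw [hLnoise s, ← hxs0] at h1
    exact h1
  -- the hypotheses of the rescaled statement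
  have hG0 : 1 / 2 ≤ P.rbScaledEnergy k E N (xs 0) := by
    rw [hxs0]
    have h := OscillatorChain.rbEnergy_eq_mul_rbScaledEnergy (P := P) (k := k) hE0 N x
    rw [h] at hGx
    by_contra hlt
    have hlt' : P.rbScaledEnergy k E N (L x) < 1 / 2 := not_le.1 hlt
    nlinarith
  have hRs : Rs E (xs 0) := by rw [hxs0]; exact hR E hE0 x hRx
  have hηsb : ∀ s ∈ Icc 0 Λ₀, ‖ηs s‖ ≤ δ₀ := fun s hs => by
    have e : ‖ηs s‖ = E ^ (-(1 / k)) * ‖η (tE * s)‖ := by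
      simp only [hηs, norm_smul, Real.norm_eq_abs, abs_of_nonneg (Real.rpow_nonneg hE0.le _)]
    rw [e]
    have h1 := hηb (tE * s) (hΛτ s hs)
    have h2 : E ^ (-(1 / k)) * (δ₀ * E ^ (1 / k)) = δ₀ := by
      rw [mul_left_comm, ← Real.rpow_add hE0, neg_add_cancel, Real.rpow_zero, mul_one]
    calc E ^ (-(1 / k)) * ‖η (tE * s)‖ ≤ E ^ (-(1 / k)) * (δ₀ * E ^ (1 / k)) :=
          mul_le_mul_of_nonneg_left h1 (Real.rpow_nonneg hE0.le _)
      _ = δ₀ := h2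
  have hGM : ∀ s ∈ Icc 0 Λ₀, P.rbScaledEnergy k E N (xs s) ≤ 4 := fun s hs => by
    have h := OscillatorChain.rbEnergy_eq_mul_rbScaledEnergy (P := P) (k := k) hE0 N (z (tE * s))
    have h4 := hGz (tE * s) (hΛτ s hs)
    rw [h] at h4
    by_contra hlt
    have hlt' : 4 < P.rbScaledEnergy k E N (xs s) := not_le.1 hlt
    have : P.rbScaledEnergy k E N (xs s) = P.rbScaledEnergy k E N (L (z (tE * s))) := rfl
    nlinarith
  have hmain := hT5 E hE xs ηs hxsc hIE hG0 hRs hηsb hGM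
  -- scale the dissipation back: (24)
  have hscale := OscillatorChain.integral_sq_eq_rpow_mul (k := k) hE0 N z Λ₀
  have hnn : 0 ≤ ∫ s in (tE * Λ₀)..τ, ((z s).2.1 ^ 2 + (z s).2.2 ^ 2) :=
    intervalIntegral.integral_nonneg (by rw [mul_comm]; exact hτ1) fun s _ => by positivity
  have hcont : Continuous fun s => (z s).2.1 ^ 2 + (z s).2.2 ^ 2 := by fun_prop
  have hsplit : ∫ s in (0 : ℝ)..τ, ((z s).2.1 ^ 2 + (z s).2.2 ^ 2) =
      (∫ s in (0 : ℝ)..(tE * Λ₀), ((z s).2.1 ^ 2 + (z s).2.2 ^ 2)) +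
        ∫ s in (tE * Λ₀)..τ, ((z s).2.1 ^ 2 + (z s).2.2 ^ 2) :=
    (intervalIntegral.integral_add_adjacent_intervals (hcont.intervalIntegrable _ _)
      (hcont.intervalIntegrable _ _)).symm
  rw [hsplit, hscale]
  have hpow : 0 ≤ E ^ (3 / k - 1 / 2) := Real.rpow_nonneg hE0.le _
  have hmain' : ε₁ ≤ ∫ s in (0 : ℝ)..Λ₀, ((L (z (tE * s))).2.1 ^ 2 + (L (z (tE * s))).2.2 ^ 2) := hmain
  have : ε₁ * E ^ (3 / k - 1 / 2) ≤ E ^ (3 / k - 1 / 2) *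
      ∫ s in (0 : ℝ)..Λ₀, ((L (z (tE * s))).2.1 ^ 2 + (L (z (tE * s))).2.2 ^ 2) := by
    rw [mul_comm ε₁]
    exact mul_le_mul_of_nonneg_left hmain' hpow
  linarith

end Transport

/-! ### The two cell dissipation bounds (CEHR Prop. 5.3 on a cell) -/

/-- The regime predicates are preserved by the rescaling: `H_pin(x) ≤ H_int(x)` iff
`H̃_pin(L_E x) ≤ H̃_int(L_E x)` (both sides scale by `E`). [cite: ReyBelletThomas2002, §3.1 (after eq. (19))] -/
theorem OscillatorChain.pinEnergy_le_intEnergy_rbScale (P : OscillatorChain) {k E : ℝ} (hE : 0 < E) (x : RBPhaseSpace N) :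
    (P.pinEnergy N x.1.1 ≤ P.intEnergy N x.1 ↔
      (P.rbScaled k E).pinEnergy N (rbScaleCLM N k E x).1.1 ≤ (P.rbScaled k E).intEnergy N (rbScaleCLM N k E x).1) ∧
    (P.intEnergy N x.1 ≤ P.pinEnergy N x.1.1 ↔
      (P.rbScaled k E).intEnergy N (rbScaleCLM N k E x).1 ≤ (P.rbScaled k E).pinEnergy N (rbScaleCLM N k E x).1.1) := by
  obtain ⟨h1, h2⟩ := OscillatorChain.intEnergy_eq_mul_rbScaled (P := P) (k := k) hE N x
  rw [h1, h2]
  exact ⟨⟨fun h => le_of_mul_le_mul_left h hE, fun h => mul_le_mul_of_nonneg_left h hE.le⟩,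
    ⟨fun h => le_of_mul_le_mul_left h hE, fun h => mul_le_mul_of_nonneg_left h hE.le⟩⟩

section Cells

variable {P : OscillatorChain} {k₁ k₂ : ℝ} (hU : RBGrowth P.U k₁) (hV : RBGrowth P.V k₂)
  (hk₁ : 2 ≤ k₁) (hk : k₁ < k₂) (hγ : 0 ≤ P.γ) {Λ : ℝ} (hΛ : Λ ≠ 0) (hN : 0 < N) {Λ₀ : ℝ} (hΛ₀ : 0 < Λ₀)
include hU hV hk₁ hk hγ hΛ hN hΛ₀

/-- **CEHR Prop. 5.3 on an INTERACTION cell, original variables** (`2 ≤ k₁ < k₂`, `Λ ≠ 0`, `N ≥ 1`,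
`γ ≥ 0`): there are `E₀ ≥ 1`, `δ₀ > 0`, `ε₁ > 0` such that for `E ≥ E₀`, a cell length
`τ ≥ Λ₀ t_i(E)` (`t_i(E) = E^{1/k₂-1/2}`), a start with `G(x) ≥ E/2` in the interaction regime
`H_pin(x) ≤ H_int(x)`, a continuous reservoir noise path with `η(0) = 0`,
`sup_{[0,τ]} ‖η‖ ≤ δ₀ E^{1/k₂}`, and energy `≤ 4E` along the cell, the driven flow dissipates
`∫₀^τ (r_L² + r_R²) ≥ ε₁ E^{3/k₂-1/2}`. [cite: ReyBelletThomas2002, Cor 3.6 & eq. (24)] -/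
theorem OscillatorChain.rb_cell_dissipation_ge_interaction :
    ∃ E₀ δ₀ ε₁ : ℝ, 1 ≤ E₀ ∧ 0 < δ₀ ∧ 0 < ε₁ ∧ ∀ ⦃E : ℝ⦄, E₀ ≤ E → ∀ ⦃τ : ℝ⦄,
      Λ₀ * timeScale k₂ E ≤ τ →
      ∀ x : RBPhaseSpace N, E / 2 ≤ P.rbEnergy N x → P.pinEnergy N x.1.1 ≤ P.intEnergy N x.1 →
        ∀ ⦃η : ℝ → ℝ × ℝ⦄, Continuous η → η 0 = 0 → (∀ s ∈ Icc 0 τ, ‖η s‖ ≤ δ₀ * E ^ (1 / k₂)) →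
          (∀ s ∈ Icc 0 τ, P.rbEnergy N (P.rbFlow Λ N x η s) ≤ 4 * E) →
            ε₁ * E ^ (3 / k₂ - 1 / 2) ≤
              ∫ s in (0 : ℝ)..τ, ((P.rbFlow Λ N x η s).2.1 ^ 2 + (P.rbFlow Λ N x η s).2.2 ^ 2) := by
  obtain ⟨E₀, δ₀, ε₁, hE₀, hδ₀, -, hε₁, hT5⟩ :=
    interaction_dissipation_lower_bound hU hV hk₁ hk hΛ hN hΛ₀ (P := P) (4 : ℝ)
  refine ⟨E₀, δ₀, ε₁, hE₀, hδ₀, hε₁, ?_⟩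
  refine OscillatorChain.rb_cell_dissipation_ge_of_scaled hU hV (by linarith) (by linarith) hγ Λ k₂ hΛ₀
    (fun x => P.pinEnergy N x.1.1 ≤ P.intEnergy N x.1)
    (fun E x => (P.rbScaled k₂ E).pinEnergy N x.1.1 ≤ (P.rbScaled k₂ E).intEnergy N x.1)
    (fun E hE x hx => ((P.pinEnergy_le_intEnergy_rbScale hE x).1).1 hx)
    hE₀ fun E hE x η hxc hIE hG hRs hη hGM => hT5 E hE x η hxc hIE hG hRs hη hGM

/-- **CEHR Prop. 5.3 on a PINNING cell, original variables** (`2 ≤ k₁ < k₂`, `Λ ≠ 0`, `N ≥ 1`,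
`γ ≥ 0`): there are `E₀ ≥ 1`, `δ₀ > 0`, `ε₁ > 0` such that for `E ≥ E₀`, a cell length
`τ ≥ Λ₀ t_p(E)` (`t_p(E) = E^{1/k₁-1/2}`), a start with `G(x) ≥ E/2` in the pinning regime
`H_int(x) ≤ H_pin(x)`, a continuous reservoir noise path with `η(0) = 0`,
`sup_{[0,τ]} ‖η‖ ≤ δ₀ E^{1/k₁}`, and energy `≤ 4E` along the cell, the driven flow dissipates
`∫₀^τ (r_L² + r_R²) ≥ ε₁ E^{3/k₁-1/2}`. [cite: ReyBelletThomas2002, Cor 3.6 & eq. (24)] -/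
theorem OscillatorChain.rb_cell_dissipation_ge_pinning :
    ∃ E₀ δ₀ ε₁ : ℝ, 1 ≤ E₀ ∧ 0 < δ₀ ∧ 0 < ε₁ ∧ ∀ ⦃E : ℝ⦄, E₀ ≤ E → ∀ ⦃τ : ℝ⦄,
      Λ₀ * timeScale k₁ E ≤ τ →
      ∀ x : RBPhaseSpace N, E / 2 ≤ P.rbEnergy N x → P.intEnergy N x.1 ≤ P.pinEnergy N x.1.1 →
        ∀ ⦃η : ℝ → ℝ × ℝ⦄, Continuous η → η 0 = 0 → (∀ s ∈ Icc 0 τ, ‖η s‖ ≤ δ₀ * E ^ (1 / k₁)) →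
          (∀ s ∈ Icc 0 τ, P.rbEnergy N (P.rbFlow Λ N x η s) ≤ 4 * E) →
            ε₁ * E ^ (3 / k₁ - 1 / 2) ≤
              ∫ s in (0 : ℝ)..τ, ((P.rbFlow Λ N x η s).2.1 ^ 2 + (P.rbFlow Λ N x η s).2.2 ^ 2) := by
  obtain ⟨E₀, δ₀, ε₁, hE₀, hδ₀, -, hε₁, hT5⟩ :=
    pinning_dissipation_lower_bound hU hV hk₁ hk hΛ hN hΛ₀ (P := P) (4 : ℝ)
  refine ⟨E₀, δ₀, ε₁, hE₀, hδ₀, hε₁, ?_⟩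
  refine OscillatorChain.rb_cell_dissipation_ge_of_scaled hU hV (by linarith) (by linarith) hγ Λ k₁ hΛ₀
    (fun x => P.intEnergy N x.1 ≤ P.pinEnergy N x.1.1)
    (fun E x => (P.rbScaled k₁ E).intEnergy N x.1 ≤ (P.rbScaled k₁ E).pinEnergy N x.1.1)
    (fun E hE x hx => ((P.pinEnergy_le_intEnergy_rbScale hE x).2).1 hx)
    hE₀ fun E hE x η hxc hIE hG hRs hη hGM => hT5 E hE x η hxc hIE hG hRs hη hGM

end Cells

end Literature.MathematicalPhysics.KineticTheory.HeatConduction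

end
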